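import Summits.BirchSwinnertonDyer.BirchSwinnertonDyer.Theorems.RamifiedHeegnerPairTwistUnitSaving
import HarnessLib

/-!
# U₁ at the SAVING ROWS of the Gss2 census (rank one), TU|saving — part F: `182700x1`, `183150y1`

Continuation of `…Theorems.RamifiedHeegnerPairTwistUnitSaving` (seat `bsd-trib-w-rhp` g15; doors, framing and data provenance there; generic kernel lemmas g14's `…TwistUnitInert`):
per rank one curve `subGss_three_/Δ_eq_/c₄_eq_/krausList_/surj_three_<label>` IN THE KERNEL, Kraus minimality of `V = E^{(-3)}_min` and of the twist model `Wd`, and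
`u1s_at_<label> : … → MissingUpperBoundAt W 3` by p674548 `LeafShimuraInert.leafRankOneUpper_three_of_shimuraInertDatum_at_saving_of_twistUnit` through
`leafRankOneUpper_three_at_saving_of_sqrtField` — printed facts `hGZK hmod hnf hJL hCO hPrim` as hypotheses; `q₁ ∣ Δ_min`, multiplicative / no-split / Tate certificates, `hFC`, `hshape` off `q₁`, (DEG), field
congruences IN THE KERNEL; `hN hr Dt hc` + the twist `L`-value + `#Ш(Wd)_an` DISPLAYED.  **HONEST FRAMING: theorems only; nothing booked, no item closed; U₁ (26022) / TU|saving / the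
Shimura-curve Heegner-system inputs stay research-level and OPEN class-wide; BSD is NOT proved for any curve by this file.**
[cite: JetchevSkinnerWan2017, §7.4.2 (p. 31)] [cite: PastenShimura2024, Prop. 6.13, Lemma 6.15, Lemma 6.18] [cite: Serre1972, §2.8] [cite: Kraus1989, Prop. 1] [cite: Cremona2006, Table 1]
-/

set_option linter.dupNamespace false
set_option autoImplicit false

noncomputable section

open scoped Classical NumberField

open WeierstrassCurve NumberField IsDedekindDomain IsDedekindDomain.HeightOneSpectrum Rat.HeightOneSpectrum Field Literature Literature.NumberTheory.DiophantineGeometry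
  Literature.NumberTheory.EllipticCurves Literature.NumberTheory.EllipticCurves.ModularForms Literature.NumberTheory.EllipticCurves.Rank1Residual
  Literature.NumberTheory.EllipticCurves.Rank1Residual.Typed Literature.NumberTheory.Automorphic Literature.NumberTheory.EllipticCurves.Rank1Residual.X11RankOneCertificates
  Literature.NumberTheory.EllipticCurves.KrizLi2019 Literature.NumberTheory.GaloisRepresentations Literature.NumberTheory.QuadraticFields Literature.NumberTheory.QuadraticFields.Quadratic
  Summit.BirchSwinnertonDyer.BirchSwinnertonDyer.Rank1Residual Summit.BirchSwinnertonDyer.BirchSwinnertonDyer.Rank1Residual.IntModel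
  Summit.BirchSwinnertonDyer.BirchSwinnertonDyer.Rank2Observatory.Tam Summit.BirchSwinnertonDyer.Rank1Residual Summit.BirchSwinnertonDyer.Rank1Residual.Additive
  Summit.BirchSwinnertonDyer.Rank1Residual.X11b Summit.BirchSwinnertonDyer.Rank1Residual.X11b.Three Summit.BirchSwinnertonDyer.Rank1Residual.X9 Summit.BirchSwinnertonDyer.Rank1Residual.GaloisImage
  Summit.BirchSwinnertonDyer.Rank1Residual.Supersingular Summit.BirchSwinnertonDyer.BirchSwinnertonDyer.Theses.RamifiedHeegnerPair Summit.BirchSwinnertonDyer.BirchSwinnertonDyer.Theorems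
  Summit.BirchSwinnertonDyer.BirchSwinnertonDyer.Theorems.SchneiderFree Summit.BirchSwinnertonDyer.BirchSwinnertonDyer.Theorems.RamifiedPairUpperBound
  Summit.BirchSwinnertonDyer.BirchSwinnertonDyer.Theorems.RamifiedHeegnerPairStepLIntrinsic Summit.BirchSwinnertonDyer.BirchSwinnertonDyer.Theorems.AdditiveBranchIMCGordTwoRankOne.HeegnerKolyvagin
  Summit.BirchSwinnertonDyer.BirchSwinnertonDyer.Theorems.RamifiedHeegnerPairTwistUnitIntrinsic Summit.BirchSwinnertonDyer.BirchSwinnertonDyer.Theorems.RamifiedHeegnerPairTwistUnitAdditive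
  Summit.BirchSwinnertonDyer.BirchSwinnertonDyer.Theorems.RamifiedHeegnerPairTwistUnitInert

namespace Summit.BirchSwinnertonDyer.BirchSwinnertonDyer.Theorems.RamifiedHeegnerPairTwistUnitSaving

open RamifiedHeegnerPairTwistUnitInert

/-! ## §9 `182700x1` = `[0, 0, 0, -9000, 418500]`, `N = 182700 = 2^2·3^2·5^2·7·29` (`2`: IV*, `c = 3`, `3`: I₀*, `c = 1`, `5`: I₀*, `c = 2`, `7`: I3, `c = 3`, split, `29`: I1, `c = 1`, split); exempted carrier `q₁ = 2` (additive IV*, `c = 3`), inert set `S = {29, 7}` (multiplicative), (DEG) très ramifié at `s₁ = 29` (`3 ∤ ord_{29} Δ = 1`);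
`ρ̄₃` onto (certificate primes `ℓ₁ = 11`, `#Ẽ(𝔽_{11}) = 14`; `ℓ₂ = 37`, `#Ẽ(𝔽_{37}) = 42`); `r_an = 1`, `#E(ℚ)_tors = 1`, `∏ c_ℓ = 18`, `#Ш(E)_an = 1` (Cremona/LMFDB, displayed where used); class `182700x` of size 1.
`V = E^{(-3)}_min = [0, 0, 0, -1000, -15500]` (`#Ṽ(𝔽₃) = 7`).  JSW field `K = ℚ(√-359)` (`359` prime; `29`, `7` inert, every other `ℓ ∣ N` split): the least such `D` with a twist unit (kit j322550: `L(E^{(-359)},1)/Ω = 48 ≠ 0`, root no. `+1`, `Wd = E^{(-359)}_min = [0, 0, 0, -1159929000, -19363274761500]`, `N(Wd) = 23546558700`, `∏c = 12`, `T = 1`, `#Ш(Wd)_an = (L/Ω)T²/∏c = 4` exactly). -/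

/-- `V = [0, 0, 0, -1000, -15500]` (the minimal model of `182700x1^{(-3)}`, conductor `20300`): `Δ ≠ 0` in the kernel. [cite: Cremona2006, Table 1 (Cremona label 182700x1)] -/
theorem isElliptic_sV182700x1 : (⟨0, 0, 0, -1000, -15500⟩ : WeierstrassCurve ℚ).IsElliptic :=
  isElliptic_of_discOf_ne_zero 0 0 0 (-1000) (-15500) (by decide +kernel)

/-- `V` is globally minimal: `|Δ| = 2^8·5^6·7^3·29` kernel-checked, Kraus' criterion prime by prime. [cite: Kraus1989, Prop. 1 and Prop. 2]
[cite: SilvermanAEC2009, VII.1 Remark 1.1] [cite: Cremona2006, Table 1 (Cremona label 182700x1)] -/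
theorem isGloballyMinimal_sV182700x1 : (⟨0, 0, 0, -1000, -15500⟩ : WeierstrassCurve ℚ).IsGloballyMinimal :=
  isGloballyMinimal_of_krausCriterion₃_factored 0 0 0 (-1000) (-15500)
    [(2, 8), (5, 6), (7, 3), (29, 1)] (by decide +kernel)
    (by intro qe hqe; simp only [List.mem_cons, List.not_mem_nil, or_false] at hqe
        rcases hqe with rfl | rfl | rfl | rfl <;> norm_num)
    (by set_option synthInstance.maxSize 2000 in decide +kernel)

/-- `Wd = [0, 0, 0, -1159929000, -19363274761500]` (the minimal model of the twist `182700x1^{(-359)}`, conductor `23546558700`): `Δ ≠ 0` in the kernel. [cite: Cremona2006, Table 1 (Cremona label 182700x1)] -/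
theorem isElliptic_sWd182700x1 : (⟨0, 0, 0, -1159929000, -19363274761500⟩ : WeierstrassCurve ℚ).IsElliptic :=
  isElliptic_of_discOf_ne_zero 0 0 0 (-1159929000) (-19363274761500) (by decide +kernel)

/-- `Wd` is globally minimal: `|Δ| = 2^8·3^6·5^6·7^3·29·359^6` kernel-checked, Kraus' criterion prime by prime. [cite: Kraus1989, Prop. 1 and Prop. 2]
[cite: SilvermanAEC2009, VII.1 Remark 1.1] [cite: Cremona2006, Table 1 (Cremona label 182700x1)] -/
theorem isGloballyMinimal_sWd182700x1 : (⟨0, 0, 0, -1159929000, -19363274761500⟩ : WeierstrassCurve ℚ).IsGloballyMinimal :=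
  isGloballyMinimal_of_krausCriterion₃_factored 0 0 0 (-1159929000) (-19363274761500)
    [(2, 8), (3, 6), (5, 6), (7, 3), (29, 1), (359, 6)] (by decide +kernel)
    (by intro qe hqe; simp only [List.mem_cons, List.not_mem_nil, or_false] at hqe
        rcases hqe with rfl | rfl | rfl | rfl | rfl | rfl <;> norm_num)
    (by set_option synthInstance.maxSize 2000 in decide +kernel)

/-- **`182700x1` is ADDITIVE at `3` and on the cell (G) ∧ ss, IN THE KERNEL**: `3 ∣ Δ`, `3 ∣ c₄`; `C • V^{(-3)} = E` (`[u, r, s, t] = [1, 0, 0, 0]`) with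
`V` globally minimal, `3 ∤ Δ(V)`, `#Ṽ(𝔽₃) = 7` (`a₃(V) = -3`, supersingular), whence `TypeG`, `SubGord`, `SubGss` at `3` (g13's block, unchanged).
[cite: SilvermanAEC2009, VII.5 Prop. 5.1 (a), (c)] [cite: Delbourgo1998, §1.5 (G)] [cite: Cremona2006, Table 1 (Cremona label 182700x1)] -/
theorem subGss_three_182700x1 {W : WeierstrassCurve ℚ} [W.IsElliptic] [W.IsGloballyMinimal] (hWeq : W = (⟨0, 0, 0, -9000, 418500⟩ : WeierstrassCurve ℚ)) :
    Addv W 3 ∧ SubGss W 3 := by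
  subst hWeq
  haveI := isElliptic_sV182700x1
  haveI := isGloballyMinimal_sV182700x1
  have hIW : integralModelInt (⟨0, 0, 0, -9000, 418500⟩ : WeierstrassCurve ℚ) = (⟨0, 0, 0, -9000, 418500⟩ : WeierstrassCurve ℤ) :=
    integralModelInt_eq_of_map_eq _ (map_mk_int 0 0 0 (-9000) 418500)
  have hadd : Addv (⟨0, 0, 0, -9000, 418500⟩ : WeierstrassCurve ℚ) 3 := Additive.addv_of_intModel hIW 3 (by decide +kernel) (by decide +kernel)
  have hIV : integralModelInt (⟨0, 0, 0, -1000, -15500⟩ : WeierstrassCurve ℚ) = (⟨0, 0, 0, -1000, -15500⟩ : WeierstrassCurve ℤ) :=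
    integralModelInt_eq_of_map_eq _ (map_mk_int 0 0 0 (-1000) (-15500))
  have hcV : Nat.card ((((⟨0, 0, 0, -1000, -15500⟩ : WeierstrassCurve ℤ)).map (Int.castRingHom (ZMod 3))).toAffine.Point) = 7 := by
    have h := natCard_point_eq_countPoints 0 0 0 (-1000) (-15500) 3 (by norm_num) (by decide +kernel)
    have h' : countPoints [0, 0, 0, -1000, -15500] 3 = 7 := countPoints_eq_of_fast (by decide +kernel)
    exact_mod_cast h.trans h'
  have hgood : GoodSS (⟨0, 0, 0, -1000, -15500⟩ : WeierstrassCurve ℚ) 3 := Supersingular.goodSS_of_intModel 3 hIV (by decide +kernel) hcV (by decide)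
  have hVW : (⟨1, (0 : ℚ), (0 : ℚ), (0 : ℚ)⟩ : VariableChange ℚ) • (⟨0, 0, 0, -1000, -15500⟩ : WeierstrassCurve ℚ).quadraticTwist (-3) =
      (⟨0, 0, 0, -9000, 418500⟩ : WeierstrassCurve ℚ) := by
    ext <;> simp [WeierstrassCurve.variableChange_a₁, WeierstrassCurve.variableChange_a₂,
      WeierstrassCurve.variableChange_a₃, WeierstrassCurve.variableChange_a₄, WeierstrassCurve.variableChange_a₆,
      WeierstrassCurve.quadraticTwist, WeierstrassCurve.b₂, WeierstrassCurve.b₄, WeierstrassCurve.b₆] <;> norm_num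
  obtain ⟨C, hC⟩ := exists_variableChange_quadraticTwist_symm (⟨0, 0, 0, -9000, 418500⟩ : WeierstrassCurve ℚ)
    (⟨0, 0, 0, -1000, -15500⟩ : WeierstrassCurve ℚ) (d := (-3 : ℚ)) (by norm_num) ⟨_, hVW⟩
  have hC' : C • (⟨0, 0, 0, -9000, 418500⟩ : WeierstrassCurve ℚ).quadraticTwist ((-1 : ℚ) ^ ((3 : ℕ) / 2) * (3 : ℕ)) =
      (⟨0, 0, 0, -1000, -15500⟩ : WeierstrassCurve ℚ) := by
    rw [O5.pstar_three]; exact hC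
  have hG : TypeG (⟨0, 0, 0, -9000, 418500⟩ : WeierstrassCurve ℚ) 3 := (typeG_three_iff_good_twist _ hadd _ C hC').mpr hgood.1
  exact ⟨hadd, (O5.subGss_three_iff_subGord_and_goodSS_twist _ hadd _ C hC).mpr
    ⟨subGord_three_of_typeG_of_addv _ hG hadd, hgood⟩⟩

/-- `Δ(E₀) = -29005452000000 = -2^8·3^6·5^6·7^3·29` on the integer equation of `182700x1`. [cite: Cremona2006, Table 1 (Cremona label 182700x1)] -/
theorem Δ_eq_182700x1 : (⟨0, 0, 0, -9000, 418500⟩ : WeierstrassCurve ℤ).Δ = -29005452000000 := by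
  norm_num [WeierstrassCurve.Δ, WeierstrassCurve.b₂, WeierstrassCurve.b₄, WeierstrassCurve.b₆, WeierstrassCurve.b₈]

/-- `c₄(E₀) = 432000` on the integer equation of `182700x1`. [cite: Cremona2006, Table 1 (Cremona label 182700x1)] -/
theorem c₄_eq_182700x1 : (⟨0, 0, 0, -9000, 418500⟩ : WeierstrassCurve ℤ).c₄ = 432000 := by
  norm_num [WeierstrassCurve.c₄, WeierstrassCurve.b₂, WeierstrassCurve.b₄]

/-- The Kraus list of `182700x1` consists of primes and multiplies to `|Δ(E₀)|`, IN THE KERNEL: a prime dividing `Δ_min` is one of `[2, 3, 5, 7, 29]`. [cite: Cremona2006, Table 1 (Cremona label 182700x1)] -/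
theorem krausList_182700x1 : (∀ qe ∈ ([(2, 8), (3, 6), (5, 6), (7, 3), (29, 1)] : List (ℕ × ℕ)), qe.1.Prime) ∧
    (([(2, 8), (3, 6), (5, 6), (7, 3), (29, 1)] : List (ℕ × ℕ)).map fun qe => qe.1 ^ qe.2).prod = (-29005452000000 : ℤ).natAbs :=
  ⟨by decide +kernel, by decide +kernel⟩

/-- **`ρ̄_{E,3}` ONTO for `182700x1`, IN THE KERNEL** (Frobenius-order witness `hasSurjectiveModNGaloisRep_of_intModel_of_irr_of_order`): at the good prime `ℓ₁ = 11` (`#Ẽ(𝔽_{11}) = 14`,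
`a = -2`) `X² − aX + 11` is irreducible mod `3`; at `ℓ₂ = 37 ≡ 1 (mod 3)` (`#Ẽ = 42`, `a = -4 ≡ 2`, `9 ∤ 42`) an element of order `3`; point counts by `countPoints_eq_of_fast`
(Sage's `is_surjective(3)` agrees). [cite: Serre1972, §2.8 Prop. 19] [cite: Zywina2015, §1] [cite: Cremona2006, Table 1 (Cremona label 182700x1)] -/
theorem surj_three_182700x1 {W : WeierstrassCurve ℚ} [W.IsElliptic] [W.IsGloballyMinimal] (hWeq : W = (⟨0, 0, 0, -9000, 418500⟩ : WeierstrassCurve ℚ)) : Surj W 3 := by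
  subst hWeq
  haveI : Fact (Nat.Prime 11) := ⟨by norm_num⟩
  haveI : Fact (Nat.Prime 37) := ⟨by norm_num⟩
  have hI : integralModelInt (⟨0, 0, 0, -9000, 418500⟩ : WeierstrassCurve ℚ) = (⟨0, 0, 0, -9000, 418500⟩ : WeierstrassCurve ℤ) :=
    integralModelInt_eq_of_map_eq _ (map_mk_int 0 0 0 (-9000) 418500)
  have hc₁ : Nat.card ((((⟨0, 0, 0, -9000, 418500⟩ : WeierstrassCurve ℤ)).map (Int.castRingHom (ZMod 11))).toAffine.Point) = 14 := by
    exact_mod_cast (natCard_point_eq_countPoints 0 0 0 (-9000) 418500 11 (by norm_num) (by decide +kernel)).trans (countPoints_eq_of_fast (n := 14) (by decide +kernel))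
  have hc₂ : Nat.card ((((⟨0, 0, 0, -9000, 418500⟩ : WeierstrassCurve ℤ)).map (Int.castRingHom (ZMod 37))).toAffine.Point) = 42 := by
    exact_mod_cast (natCard_point_eq_countPoints 0 0 0 (-9000) 418500 37 (by norm_num) (by decide +kernel)).trans (countPoints_eq_of_fast (n := 42) (by decide +kernel))
  exact hasSurjectiveModNGaloisRep_of_intModel_of_irr_of_order hI 3 11 37 (by norm_num) (by norm_num) (by rw [Δ_eq_182700x1]; norm_num)
    (by rw [Δ_eq_182700x1]; norm_num) hc₁ hc₂ (by decide) (by decide) (by decide) (by decide)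

/-- **U₁ AT `182700x1` ON ITS SAVING ROW (inert-set Shimura-curve road, TU|saving)** — `MissingUpperBoundAt W 3` at `W = E` from rhp-p2 g11's shape p674548
`leafRankOneUpper_three_of_shimuraInertDatum_at_saving_of_twistUnit` through the door `leafRankOneUpper_three_at_saving_of_sqrtField`.  PRINTED: `hGZK hmod hnf hJL hCO hPrim`.  KERNEL: `Addv ∧ SubGss` at `3`; `ρ̄₃` onto;
`q₁ = 2 ∣ Δ_min`; `29`, `7` multiplicative; every prime of `Δ_min` enumerated (`krausList_182700x1`) for `hFC` and for `hshape` off `q₁` (`c = 1` off `Δ_min`, Kodaira–Néron at multiplicative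
primes, Tate certificates at the additive primes `[3, 5]`); (DEG) très ramifié at `s₁ = 29`; the congruences making `29`, `7` inert and the other `ℓ ∣ N` split in
`ℚ(√-359)`; `Cd • E^{(-359)} = Wd`, `Cd = [1, 0, 0, 0]`, `Wd` Kraus-minimal.  DISPLAYED: `hN`, `hr`, `Dt`/`hc` (`3 ∤ c(Dt)`), `hLt` (`L(E^{(-359)},1) ≠ 0`),
`hqd`/`hvd` (`#Ш(Wd)_an = 4`).  NO S2 / Σ / L₀.  Per curve; U₁ (26022) stays OPEN class-wide (`BSDp W 3` then by `bsdp_three_of_upper_of_shaAn_unit`); BSD is NOT proved by this.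
[cite: JetchevSkinnerWan2017, §7.4.2 (p. 31)] [cite: PastenShimura2024, Prop. 6.13, Lemma 6.15, Lemma 6.18] [cite: SilvermanAEC2009, VII.5 Prop. 5.1] [cite: Cremona2006, Table 1 (Cremona label 182700x1)] -/
theorem u1s_at_182700x1
    (hGZK : rank_eq_analyticRank_of_analyticRank_le_one) (hmod : hasEntireLFunction_rat)
    (hnf : exists_isNewformOf) (hJL : nonempty_shimuraParametrizationData)
    (hCO : PastenShimura2024_componentOrders) (hPrim : shimuraCurve_heegnerSystem_primitivesAtThree)
    {W : WeierstrassCurve ℚ} [W.IsElliptic] [W.IsGloballyMinimal] (hWeq : W = (⟨0, 0, 0, -9000, 418500⟩ : WeierstrassCurve ℚ))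
    (hN : W.conductorNorm ℤ = 182700) [NeZero (W.conductorNorm ℤ)] (hr : W.analyticRank = 1)
    (Dt : ModularParametrizationData W (W.conductorNorm ℤ)) (hc : ¬ (3 : ℤ) ∣ Dt.c)
    (hLt : (W.quadraticTwist (((-359 : ℤ) : ℚ))).entireLFunction 1 ≠ 0)
    {qd : ℚ} (hqd : haveI := isElliptic_sWd182700x1; shaAn (⟨0, 0, 0, -1159929000, -19363274761500⟩ : WeierstrassCurve ℚ) = (qd : ℂ))
    (hvd : padicValRat 3 qd ≤ 0) :
    MissingUpperBoundAt W 3 := by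
  subst hWeq
  haveI := isElliptic_sWd182700x1; haveI := isGloballyMinimal_sWd182700x1
  have hI : integralModelInt (⟨0, 0, 0, -9000, 418500⟩ : WeierstrassCurve ℚ) = (⟨0, 0, 0, -9000, 418500⟩ : WeierstrassCurve ℤ) :=
    integralModelInt_eq_of_map_eq _ (map_mk_int 0 0 0 (-9000) 418500)
  have hGS := subGss_three_182700x1 (W := (⟨0, 0, 0, -9000, 418500⟩ : WeierstrassCurve ℚ)) rfl
  have hsurj := surj_three_182700x1 (W := (⟨0, 0, 0, -9000, 418500⟩ : WeierstrassCurve ℚ)) rfl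
  haveI : Fact ((-359 : ℤ) < 0) := ⟨by norm_num⟩; haveI : Fact (Nat.Prime 2) := ⟨by norm_num⟩
  haveI : Fact (Nat.Prime 29) := ⟨by norm_num⟩; haveI : Fact (Nat.Prime 7) := ⟨by norm_num⟩
  have hbad₁ := WeierstrassCurve.not_hasGoodReductionAtPrime_of_dvd_minimalDiscriminantInt (⟨0, 0, 0, -9000, 418500⟩ : WeierstrassCurve ℚ) 2 (by rw [IntModel.minimalDiscriminantInt_eq hI, Δ_eq_182700x1]; norm_num)
  have hm₁ : (⟨0, 0, 0, -9000, 418500⟩ : WeierstrassCurve ℚ).HasMultiplicativeReductionAtPrime 29 := IntModel.hasMultiplicativeReductionAtPrime_of_intModel hI 29 (by rw [Δ_eq_182700x1]; norm_num) (by rw [c₄_eq_182700x1]; norm_num)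
  have hm₂ : (⟨0, 0, 0, -9000, 418500⟩ : WeierstrassCurve ℚ).HasMultiplicativeReductionAtPrime 7 := IntModel.hasMultiplicativeReductionAtPrime_of_intModel hI 7 (by rw [Δ_eq_182700x1]; norm_num) (by rw [c₄_eq_182700x1]; norm_num)
  have hFC : ∀ (ℓ : ℕ) [Fact ℓ.Prime], ℓ ≠ 29 → ℓ ≠ 7 → ℓ ≠ 2 → (⟨0, 0, 0, -9000, 418500⟩ : WeierstrassCurve ℚ).HasSplitMultiplicativeReductionAtPrime ℓ →
      ¬ 3 ∣ padicValInt ℓ (⟨0, 0, 0, -9000, 418500⟩ : WeierstrassCurve ℚ).minimalDiscriminantInt := by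
    intro ℓ hℓF hne₁ hne₂ hneq hs
    have hd := dvd_minimalDiscriminantInt_of_mult _ ℓ hs.hasMultiplicativeReductionAtPrime
    rw [IntModel.minimalDiscriminantInt_eq hI, Δ_eq_182700x1] at hd
    have hmem := mem_of_prime_dvd_of_prodPow_eq _ krausList_182700x1 hℓF.out hd
    simp only [List.map_cons, List.map_nil, List.mem_cons, List.not_mem_nil, or_false] at hmem
    rcases hmem with rfl | rfl | rfl | rfl | rfl
    · exact absurd rfl hneq
    · exact absurd hs.hasMultiplicativeReductionAtPrime (X9.PrintCert.not_hasMultiplicativeReductionAtPrime_of_dvd_of_dvd hI 3 (by rw [Δ_eq_182700x1]; norm_num) (by rw [c₄_eq_182700x1]; norm_num))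
    · exact absurd hs.hasMultiplicativeReductionAtPrime (X9.PrintCert.not_hasMultiplicativeReductionAtPrime_of_dvd_of_dvd hI 5 (by rw [Δ_eq_182700x1]; norm_num) (by rw [c₄_eq_182700x1]; norm_num))
    · exact absurd rfl hne₂
    · exact absurd rfl hne₁
  have hshape : ∀ (q : ℕ) [Fact q.Prime], q ≠ 2 → 3 ∣ ((⟨0, 0, 0, -9000, 418500⟩ : WeierstrassCurve ℚ).baseChange ℚ_[q]).localTamagawaNumber ℤ_[q] →
      (⟨0, 0, 0, -9000, 418500⟩ : WeierstrassCurve ℚ).HasSplitMultiplicativeReductionAtPrime q := by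
    intro q hqF hq h3
    by_cases hd : (q : ℤ) ∣ minimalDiscriminantInt (⟨0, 0, 0, -9000, 418500⟩ : WeierstrassCurve ℚ)
    swap
    · exact absurd h3 (not_three_dvd_localTamagawaNumber_of_not_dvd _ q hd)
    rw [IntModel.minimalDiscriminantInt_eq hI, Δ_eq_182700x1] at hd
    have hmem := mem_of_prime_dvd_of_prodPow_eq _ krausList_182700x1 hqF.out hd
    simp only [List.map_cons, List.map_nil, List.mem_cons, List.not_mem_nil, or_false] at hmem
    rcases hmem with rfl | rfl | rfl | rfl | rfl
    · exact absurd rfl hq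
    · have hc3 : ((⟨0, 0, 0, -9000, 418500⟩ : WeierstrassCurve ℚ).baseChange ℚ_[3]).localTamagawaNumber ℤ_[3] = 1 := -- additive `3` (I0*): Tate certificate
        (IntModelTam.localTamagawaNumber_padic_eq_of_intModel_of_tamZ hI 3 (F := ⟨3, 9, 0, 0, 0, 6, 0, 0⟩) rfl (by decide +kernel)).trans (by decide)
      rw [hc3] at h3; exact absurd h3 (by decide)
    · have hc5 : ((⟨0, 0, 0, -9000, 418500⟩ : WeierstrassCurve ℚ).baseChange ℚ_[5]).localTamagawaNumber ℤ_[5] = 2 := -- additive `5` (I0*): Tate certificate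
        (IntModelTam.localTamagawaNumber_padic_eq_of_intModel_of_tamZ hI 5 (F := ⟨5, 9, 0, 0, 0, 6, 0, 1⟩) rfl (by decide +kernel)).trans (by decide)
      rw [hc5] at h3; exact absurd h3 (by decide)
    · exact (Koly.split_and_three_dvd_of_mult_of_three_dvd_localTamagawaNumber _ 7 (IntModel.hasMultiplicativeReductionAtPrime_of_intModel hI 7 (by rw [Δ_eq_182700x1]; norm_num) (by rw [c₄_eq_182700x1]; norm_num)) h3).1
    · exact (Koly.split_and_three_dvd_of_mult_of_three_dvd_localTamagawaNumber _ 29 (IntModel.hasMultiplicativeReductionAtPrime_of_intModel hI 29 (by rw [Δ_eq_182700x1]; norm_num) (by rw [c₄_eq_182700x1]; norm_num)) h3).1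
  have hjac : ∀ ℓ : ℕ, ℓ.Prime → ℓ ∣ (⟨0, 0, 0, -9000, 418500⟩ : WeierstrassCurve ℚ).conductorNorm ℤ → ℓ ≠ 29 → ℓ ≠ 7 → ℓ ≠ 2 →
      jacobiSym (-359) ℓ = 1 := by
    intro ℓ hℓ hℓN hne₁ hne₂ hℓ2
    rw [hN] at hℓN
    have hmem : ℓ ∈ Nat.primeFactors 182700 := Nat.mem_primeFactors.mpr ⟨hℓ, hℓN, by norm_num⟩
    rw [show Nat.primeFactors 182700 = {2, 3, 5, 7, 29} by decide +kernel] at hmem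
    simp only [Finset.mem_insert, Finset.mem_singleton] at hmem
    rcases hmem with rfl | rfl | rfl | rfl | rfl
    · exact absurd rfl hℓ2
    · norm_num [jacobiSym.mod_left]
    · norm_num [jacobiSym.mod_left]
    · exact absurd rfl hne₂
    · exact absurd rfl hne₁
  have hWd : (⟨1, (0 : ℚ), (0 : ℚ), (0 : ℚ)⟩ : VariableChange ℚ) • (⟨0, 0, 0, -9000, 418500⟩ : WeierstrassCurve ℚ).quadraticTwist (((-359 : ℤ) : ℚ)) =
      (⟨0, 0, 0, -1159929000, -19363274761500⟩ : WeierstrassCurve ℚ) := by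
    push_cast; ext <;> simp [WeierstrassCurve.variableChange_a₁, WeierstrassCurve.variableChange_a₂,
      WeierstrassCurve.variableChange_a₃, WeierstrassCurve.variableChange_a₄, WeierstrassCurve.variableChange_a₆,
      WeierstrassCurve.quadraticTwist, WeierstrassCurve.b₂, WeierstrassCurve.b₄, WeierstrassCurve.b₆] <;> norm_num
  exact leafRankOneUpper_three_at_saving_of_sqrtField hGZK hmod hnf hJL hCO hPrim _ hGS.1 hGS.2 hr hsurj rfl Dt hc 2 hbad₁
    (s₁ := 29) (s₂ := 7) (by decide) (by decide) (by decide) hm₁ hm₂ hFC hshape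
    (Or.inl (by rw [IntModel.minimalDiscriminantInt_eq hI, Δ_eq_182700x1, IntModel.padicValInt_eq_of_dvd_of_not_dvd 29 (e := 1) (by norm_num) (by norm_num)]; decide))
    (-359) (by norm_num) (by rw [show (-359 : ℤ).natAbs = 359 by rfl, Nat.squarefree_iff_nodup_primeFactorsList (by norm_num)]; simp)
    (Or.inr ⟨by decide, by norm_num [jacobiSym.mod_left]⟩) (by norm_num) (Or.inr ⟨by decide, by norm_num [jacobiSym.mod_left]⟩) (by norm_num) hjac
    (fun _ _ _ ↦ by norm_num) hLt _ _ hWd hqd hvd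

/-! ## §10 `183150y1` = `[1, -1, 1, -2180, 272785447]`, `N = 183150 = 2·3^2·5^2·11·37` (`2`: I9, `c = 9`, split, `3`: I₀*, `c = 2`, `5`: IV*, `c = 3`, `11`: I5, `c = 1`, non-split, `37`: I2, `c = 2`, split); exempted carrier `q₁ = 5` (additive IV*, `c = 3`), inert set `S = {11, 2}` (multiplicative), (DEG) très ramifié at `s₁ = 11` (`3 ∤ ord_{11} Δ = 5`);
`ρ̄₃` onto (certificate primes `ℓ₁ = 17`, `#Ẽ(𝔽_{17}) = 16`; `ℓ₂ = 13`, `#Ẽ(𝔽_{13}) = 15`); `r_an = 1`, `#E(ℚ)_tors = 1`, `∏ c_ℓ = 108`, `#Ш(E)_an = 1` (Cremona/LMFDB, displayed where used); class `183150y` of size 1.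
`V = E^{(-3)}_min = [1, -1, 0, -242, -10103084]` (`#Ṽ(𝔽₃) = 4`).  JSW field `K = ℚ(√-419)` (`419` prime; `11`, `2` inert, every other `ℓ ∣ N` split): the least such `D` with a twist unit (kit j322550: `L(E^{(-419)},1)/Ω = 120 ≠ 0`, root no. `+1`, `Wd = E^{(-419)}_min = [1, -1, 0, -382668117, -20066073415048459]`, `N(Wd) = 32153997150`, `∏c = 120`, `T = 1`, `#Ш(Wd)_an = (L/Ω)T²/∏c = 1` exactly). -/

/-- `V = [1, -1, 0, -242, -10103084]` (the minimal model of `183150y1^{(-3)}`, conductor `20350`): `Δ ≠ 0` in the kernel. [cite: Cremona2006, Table 1 (Cremona label 183150y1)] -/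
theorem isElliptic_sV183150y1 : (⟨1, -1, 0, -242, -10103084⟩ : WeierstrassCurve ℚ).IsElliptic :=
  isElliptic_of_discOf_ne_zero 1 (-1) 0 (-242) (-10103084) (by decide +kernel)

/-- `V` is globally minimal: `|Δ| = 2^9·5^8·11^5·37^2` kernel-checked, Kraus' criterion prime by prime. [cite: Kraus1989, Prop. 1 and Prop. 2]
[cite: SilvermanAEC2009, VII.1 Remark 1.1] [cite: Cremona2006, Table 1 (Cremona label 183150y1)] -/
theorem isGloballyMinimal_sV183150y1 : (⟨1, -1, 0, -242, -10103084⟩ : WeierstrassCurve ℚ).IsGloballyMinimal :=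
  isGloballyMinimal_of_krausCriterion₃_factored 1 (-1) 0 (-242) (-10103084)
    [(2, 9), (5, 8), (11, 5), (37, 2)] (by decide +kernel)
    (by intro qe hqe; simp only [List.mem_cons, List.not_mem_nil, or_false] at hqe
        rcases hqe with rfl | rfl | rfl | rfl <;> norm_num)
    (by set_option synthInstance.maxSize 2000 in decide +kernel)

/-- `Wd = [1, -1, 0, -382668117, -20066073415048459]` (the minimal model of the twist `183150y1^{(-419)}`, conductor `32153997150`): `Δ ≠ 0` in the kernel. [cite: Cremona2006, Table 1 (Cremona label 183150y1)] -/
theorem isElliptic_sWd183150y1 : (⟨1, -1, 0, -382668117, -20066073415048459⟩ : WeierstrassCurve ℚ).IsElliptic :=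
  isElliptic_of_discOf_ne_zero 1 (-1) 0 (-382668117) (-20066073415048459) (by decide +kernel)

/-- `Wd` is globally minimal: `|Δ| = 2^9·3^6·5^8·11^5·37^2·419^6` kernel-checked, Kraus' criterion prime by prime. [cite: Kraus1989, Prop. 1 and Prop. 2]
[cite: SilvermanAEC2009, VII.1 Remark 1.1] [cite: Cremona2006, Table 1 (Cremona label 183150y1)] -/
theorem isGloballyMinimal_sWd183150y1 : (⟨1, -1, 0, -382668117, -20066073415048459⟩ : WeierstrassCurve ℚ).IsGloballyMinimal :=
  isGloballyMinimal_of_krausCriterion₃_factored 1 (-1) 0 (-382668117) (-20066073415048459)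
    [(2, 9), (3, 6), (5, 8), (11, 5), (37, 2), (419, 6)] (by decide +kernel)
    (by intro qe hqe; simp only [List.mem_cons, List.not_mem_nil, or_false] at hqe
        rcases hqe with rfl | rfl | rfl | rfl | rfl | rfl <;> norm_num)
    (by set_option synthInstance.maxSize 2000 in decide +kernel)

/-- **`183150y1` is ADDITIVE at `3` and on the cell (G) ∧ ss, IN THE KERNEL**: `3 ∣ Δ`, `3 ∣ c₄`; `C • V^{(-3)} = E` (`[u, r, s, t] = [1, -1, 1/2, 1/2]`) with
`V` globally minimal, `3 ∤ Δ(V)`, `#Ṽ(𝔽₃) = 4` (`a₃(V) = 0`, supersingular), whence `TypeG`, `SubGord`, `SubGss` at `3` (g13's block, unchanged).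
[cite: SilvermanAEC2009, VII.5 Prop. 5.1 (a), (c)] [cite: Delbourgo1998, §1.5 (G)] [cite: Cremona2006, Table 1 (Cremona label 183150y1)] -/
theorem subGss_three_183150y1 {W : WeierstrassCurve ℚ} [W.IsElliptic] [W.IsGloballyMinimal] (hWeq : W = (⟨1, -1, 1, -2180, 272785447⟩ : WeierstrassCurve ℚ)) :
    Addv W 3 ∧ SubGss W 3 := by
  subst hWeq
  haveI := isElliptic_sV183150y1
  haveI := isGloballyMinimal_sV183150y1
  have hIW : integralModelInt (⟨1, -1, 1, -2180, 272785447⟩ : WeierstrassCurve ℚ) = (⟨1, -1, 1, -2180, 272785447⟩ : WeierstrassCurve ℤ) :=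
    integralModelInt_eq_of_map_eq _ (map_mk_int 1 (-1) 1 (-2180) 272785447)
  have hadd : Addv (⟨1, -1, 1, -2180, 272785447⟩ : WeierstrassCurve ℚ) 3 := Additive.addv_of_intModel hIW 3 (by decide +kernel) (by decide +kernel)
  have hIV : integralModelInt (⟨1, -1, 0, -242, -10103084⟩ : WeierstrassCurve ℚ) = (⟨1, -1, 0, -242, -10103084⟩ : WeierstrassCurve ℤ) :=
    integralModelInt_eq_of_map_eq _ (map_mk_int 1 (-1) 0 (-242) (-10103084))
  have hcV : Nat.card ((((⟨1, -1, 0, -242, -10103084⟩ : WeierstrassCurve ℤ)).map (Int.castRingHom (ZMod 3))).toAffine.Point) = 4 := by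
    have h := natCard_point_eq_countPoints 1 (-1) 0 (-242) (-10103084) 3 (by norm_num) (by decide +kernel)
    have h' : countPoints [1, -1, 0, -242, -10103084] 3 = 4 := countPoints_eq_of_fast (by decide +kernel)
    exact_mod_cast h.trans h'
  have hgood : GoodSS (⟨1, -1, 0, -242, -10103084⟩ : WeierstrassCurve ℚ) 3 := Supersingular.goodSS_of_intModel 3 hIV (by decide +kernel) hcV (by decide)
  have hVW : (⟨1, (-1 : ℚ), ((1:ℚ)/2), ((1:ℚ)/2)⟩ : VariableChange ℚ) • (⟨1, -1, 0, -242, -10103084⟩ : WeierstrassCurve ℚ).quadraticTwist (-3) =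
      (⟨1, -1, 1, -2180, 272785447⟩ : WeierstrassCurve ℚ) := by
    ext <;> simp [WeierstrassCurve.variableChange_a₁, WeierstrassCurve.variableChange_a₂,
      WeierstrassCurve.variableChange_a₃, WeierstrassCurve.variableChange_a₄, WeierstrassCurve.variableChange_a₆,
      WeierstrassCurve.quadraticTwist, WeierstrassCurve.b₂, WeierstrassCurve.b₄, WeierstrassCurve.b₆] <;> norm_num
  obtain ⟨C, hC⟩ := exists_variableChange_quadraticTwist_symm (⟨1, -1, 1, -2180, 272785447⟩ : WeierstrassCurve ℚ)
    (⟨1, -1, 0, -242, -10103084⟩ : WeierstrassCurve ℚ) (d := (-3 : ℚ)) (by norm_num) ⟨_, hVW⟩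
  have hC' : C • (⟨1, -1, 1, -2180, 272785447⟩ : WeierstrassCurve ℚ).quadraticTwist ((-1 : ℚ) ^ ((3 : ℕ) / 2) * (3 : ℕ)) =
      (⟨1, -1, 0, -242, -10103084⟩ : WeierstrassCurve ℚ) := by
    rw [O5.pstar_three]; exact hC
  have hG : TypeG (⟨1, -1, 1, -2180, 272785447⟩ : WeierstrassCurve ℚ) 3 := (typeG_three_iff_good_twist _ hadd _ C hC').mpr hgood.1
  exact ⟨hadd, (O5.subGss_three_iff_subGord_and_goodSS_twist _ hadd _ C hC).mpr
    ⟨subGord_three_of_typeG_of_addv _ hG hadd, hgood⟩⟩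

/-- `Δ(E₀) = -32145811810200000000 = -2^9·3^6·5^8·11^5·37^2` on the integer equation of `183150y1`. [cite: Cremona2006, Table 1 (Cremona label 183150y1)] -/
theorem Δ_eq_183150y1 : (⟨1, -1, 1, -2180, 272785447⟩ : WeierstrassCurve ℤ).Δ = -32145811810200000000 := by
  norm_num [WeierstrassCurve.Δ, WeierstrassCurve.b₂, WeierstrassCurve.b₄, WeierstrassCurve.b₆, WeierstrassCurve.b₈]

/-- `c₄(E₀) = 104625` on the integer equation of `183150y1`. [cite: Cremona2006, Table 1 (Cremona label 183150y1)] -/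
theorem c₄_eq_183150y1 : (⟨1, -1, 1, -2180, 272785447⟩ : WeierstrassCurve ℤ).c₄ = 104625 := by
  norm_num [WeierstrassCurve.c₄, WeierstrassCurve.b₂, WeierstrassCurve.b₄]

/-- The Kraus list of `183150y1` consists of primes and multiplies to `|Δ(E₀)|`, IN THE KERNEL: a prime dividing `Δ_min` is one of `[2, 3, 5, 11, 37]`. [cite: Cremona2006, Table 1 (Cremona label 183150y1)] -/
theorem krausList_183150y1 : (∀ qe ∈ ([(2, 9), (3, 6), (5, 8), (11, 5), (37, 2)] : List (ℕ × ℕ)), qe.1.Prime) ∧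
    (([(2, 9), (3, 6), (5, 8), (11, 5), (37, 2)] : List (ℕ × ℕ)).map fun qe => qe.1 ^ qe.2).prod = (-32145811810200000000 : ℤ).natAbs :=
  ⟨by decide +kernel, by decide +kernel⟩

/-- **`ρ̄_{E,3}` ONTO for `183150y1`, IN THE KERNEL** (Frobenius-order witness `hasSurjectiveModNGaloisRep_of_intModel_of_irr_of_order`): at the good prime `ℓ₁ = 17` (`#Ẽ(𝔽_{17}) = 16`,
`a = 2`) `X² − aX + 17` is irreducible mod `3`; at `ℓ₂ = 13 ≡ 1 (mod 3)` (`#Ẽ = 15`, `a = -1 ≡ 2`, `9 ∤ 15`) an element of order `3`; point counts by `countPoints_eq_of_fast`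
(Sage's `is_surjective(3)` agrees). [cite: Serre1972, §2.8 Prop. 19] [cite: Zywina2015, §1] [cite: Cremona2006, Table 1 (Cremona label 183150y1)] -/
theorem surj_three_183150y1 {W : WeierstrassCurve ℚ} [W.IsElliptic] [W.IsGloballyMinimal] (hWeq : W = (⟨1, -1, 1, -2180, 272785447⟩ : WeierstrassCurve ℚ)) : Surj W 3 := by
  subst hWeq
  haveI : Fact (Nat.Prime 17) := ⟨by norm_num⟩
  haveI : Fact (Nat.Prime 13) := ⟨by norm_num⟩
  have hI : integralModelInt (⟨1, -1, 1, -2180, 272785447⟩ : WeierstrassCurve ℚ) = (⟨1, -1, 1, -2180, 272785447⟩ : WeierstrassCurve ℤ) :=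
    integralModelInt_eq_of_map_eq _ (map_mk_int 1 (-1) 1 (-2180) 272785447)
  have hc₁ : Nat.card ((((⟨1, -1, 1, -2180, 272785447⟩ : WeierstrassCurve ℤ)).map (Int.castRingHom (ZMod 17))).toAffine.Point) = 16 := by
    exact_mod_cast (natCard_point_eq_countPoints 1 (-1) 1 (-2180) 272785447 17 (by norm_num) (by decide +kernel)).trans (countPoints_eq_of_fast (n := 16) (by decide +kernel))
  have hc₂ : Nat.card ((((⟨1, -1, 1, -2180, 272785447⟩ : WeierstrassCurve ℤ)).map (Int.castRingHom (ZMod 13))).toAffine.Point) = 15 := by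
    exact_mod_cast (natCard_point_eq_countPoints 1 (-1) 1 (-2180) 272785447 13 (by norm_num) (by decide +kernel)).trans (countPoints_eq_of_fast (n := 15) (by decide +kernel))
  exact hasSurjectiveModNGaloisRep_of_intModel_of_irr_of_order hI 3 17 13 (by norm_num) (by norm_num) (by rw [Δ_eq_183150y1]; norm_num)
    (by rw [Δ_eq_183150y1]; norm_num) hc₁ hc₂ (by decide) (by decide) (by decide) (by decide)

/-- **U₁ AT `183150y1` ON ITS SAVING ROW (inert-set Shimura-curve road, TU|saving)** — `MissingUpperBoundAt W 3` at `W = E` from rhp-p2 g11's shape p674548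
`leafRankOneUpper_three_of_shimuraInertDatum_at_saving_of_twistUnit` through the door `leafRankOneUpper_three_at_saving_of_sqrtField`.  PRINTED: `hGZK hmod hnf hJL hCO hPrim`.  KERNEL: `Addv ∧ SubGss` at `3`; `ρ̄₃` onto;
`q₁ = 5 ∣ Δ_min`; `11`, `2` multiplicative; every prime of `Δ_min` enumerated (`krausList_183150y1`) for `hFC` and for `hshape` off `q₁` (`c = 1` off `Δ_min`, Kodaira–Néron at multiplicative
primes, Tate certificates at the additive primes `[3]`); (DEG) très ramifié at `s₁ = 11`; the congruences making `11`, `2` inert and the other `ℓ ∣ N` split in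
`ℚ(√-419)`; `Cd • E^{(-419)} = Wd`, `Cd = [1, -105, 1/2, 0]`, `Wd` Kraus-minimal.  DISPLAYED: `hN`, `hr`, `Dt`/`hc` (`3 ∤ c(Dt)`), `hLt` (`L(E^{(-419)},1) ≠ 0`),
`hqd`/`hvd` (`#Ш(Wd)_an = 1`).  NO S2 / Σ / L₀.  Per curve; U₁ (26022) stays OPEN class-wide (`BSDp W 3` then by `bsdp_three_of_upper_of_shaAn_unit`); BSD is NOT proved by this.
[cite: JetchevSkinnerWan2017, §7.4.2 (p. 31)] [cite: PastenShimura2024, Prop. 6.13, Lemma 6.15, Lemma 6.18] [cite: SilvermanAEC2009, VII.5 Prop. 5.1] [cite: Cremona2006, Table 1 (Cremona label 183150y1)] -/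
theorem u1s_at_183150y1
    (hGZK : rank_eq_analyticRank_of_analyticRank_le_one) (hmod : hasEntireLFunction_rat)
    (hnf : exists_isNewformOf) (hJL : nonempty_shimuraParametrizationData)
    (hCO : PastenShimura2024_componentOrders) (hPrim : shimuraCurve_heegnerSystem_primitivesAtThree)
    {W : WeierstrassCurve ℚ} [W.IsElliptic] [W.IsGloballyMinimal] (hWeq : W = (⟨1, -1, 1, -2180, 272785447⟩ : WeierstrassCurve ℚ))
    (hN : W.conductorNorm ℤ = 183150) [NeZero (W.conductorNorm ℤ)] (hr : W.analyticRank = 1)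
    (Dt : ModularParametrizationData W (W.conductorNorm ℤ)) (hc : ¬ (3 : ℤ) ∣ Dt.c)
    (hLt : (W.quadraticTwist (((-419 : ℤ) : ℚ))).entireLFunction 1 ≠ 0)
    {qd : ℚ} (hqd : haveI := isElliptic_sWd183150y1; shaAn (⟨1, -1, 0, -382668117, -20066073415048459⟩ : WeierstrassCurve ℚ) = (qd : ℂ))
    (hvd : padicValRat 3 qd ≤ 0) :
    MissingUpperBoundAt W 3 := by
  subst hWeq
  haveI := isElliptic_sWd183150y1; haveI := isGloballyMinimal_sWd183150y1
  have hI : integralModelInt (⟨1, -1, 1, -2180, 272785447⟩ : WeierstrassCurve ℚ) = (⟨1, -1, 1, -2180, 272785447⟩ : WeierstrassCurve ℤ) :=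
    integralModelInt_eq_of_map_eq _ (map_mk_int 1 (-1) 1 (-2180) 272785447)
  have hGS := subGss_three_183150y1 (W := (⟨1, -1, 1, -2180, 272785447⟩ : WeierstrassCurve ℚ)) rfl
  have hsurj := surj_three_183150y1 (W := (⟨1, -1, 1, -2180, 272785447⟩ : WeierstrassCurve ℚ)) rfl
  haveI : Fact ((-419 : ℤ) < 0) := ⟨by norm_num⟩; haveI : Fact (Nat.Prime 5) := ⟨by norm_num⟩
  haveI : Fact (Nat.Prime 11) := ⟨by norm_num⟩; haveI : Fact (Nat.Prime 2) := ⟨by norm_num⟩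
  have hbad₁ := WeierstrassCurve.not_hasGoodReductionAtPrime_of_dvd_minimalDiscriminantInt (⟨1, -1, 1, -2180, 272785447⟩ : WeierstrassCurve ℚ) 5 (by rw [IntModel.minimalDiscriminantInt_eq hI, Δ_eq_183150y1]; norm_num)
  have hm₁ : (⟨1, -1, 1, -2180, 272785447⟩ : WeierstrassCurve ℚ).HasMultiplicativeReductionAtPrime 11 := IntModel.hasMultiplicativeReductionAtPrime_of_intModel hI 11 (by rw [Δ_eq_183150y1]; norm_num) (by rw [c₄_eq_183150y1]; norm_num)
  have hm₂ : (⟨1, -1, 1, -2180, 272785447⟩ : WeierstrassCurve ℚ).HasMultiplicativeReductionAtPrime 2 := IntModel.hasMultiplicativeReductionAtPrime_of_intModel hI 2 (by rw [Δ_eq_183150y1]; norm_num) (by rw [c₄_eq_183150y1]; norm_num)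
  have hFC : ∀ (ℓ : ℕ) [Fact ℓ.Prime], ℓ ≠ 11 → ℓ ≠ 2 → ℓ ≠ 5 → (⟨1, -1, 1, -2180, 272785447⟩ : WeierstrassCurve ℚ).HasSplitMultiplicativeReductionAtPrime ℓ →
      ¬ 3 ∣ padicValInt ℓ (⟨1, -1, 1, -2180, 272785447⟩ : WeierstrassCurve ℚ).minimalDiscriminantInt := by
    intro ℓ hℓF hne₁ hne₂ hneq hs
    have hd := dvd_minimalDiscriminantInt_of_mult _ ℓ hs.hasMultiplicativeReductionAtPrime
    rw [IntModel.minimalDiscriminantInt_eq hI, Δ_eq_183150y1] at hd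
    have hmem := mem_of_prime_dvd_of_prodPow_eq _ krausList_183150y1 hℓF.out hd
    simp only [List.map_cons, List.map_nil, List.mem_cons, List.not_mem_nil, or_false] at hmem
    rcases hmem with rfl | rfl | rfl | rfl | rfl
    · exact absurd rfl hne₂
    · exact absurd hs.hasMultiplicativeReductionAtPrime (X9.PrintCert.not_hasMultiplicativeReductionAtPrime_of_dvd_of_dvd hI 3 (by rw [Δ_eq_183150y1]; norm_num) (by rw [c₄_eq_183150y1]; norm_num))
    · exact absurd rfl hneq
    · exact absurd rfl hne₁
    · rw [IntModel.minimalDiscriminantInt_eq hI, Δ_eq_183150y1, IntModel.padicValInt_eq_of_dvd_of_not_dvd 37 (e := 2) (by norm_num) (by norm_num)]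
      decide
  have hshape : ∀ (q : ℕ) [Fact q.Prime], q ≠ 5 → 3 ∣ ((⟨1, -1, 1, -2180, 272785447⟩ : WeierstrassCurve ℚ).baseChange ℚ_[q]).localTamagawaNumber ℤ_[q] →
      (⟨1, -1, 1, -2180, 272785447⟩ : WeierstrassCurve ℚ).HasSplitMultiplicativeReductionAtPrime q := by
    intro q hqF hq h3
    by_cases hd : (q : ℤ) ∣ minimalDiscriminantInt (⟨1, -1, 1, -2180, 272785447⟩ : WeierstrassCurve ℚ)
    swap
    · exact absurd h3 (not_three_dvd_localTamagawaNumber_of_not_dvd _ q hd)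
    rw [IntModel.minimalDiscriminantInt_eq hI, Δ_eq_183150y1] at hd
    have hmem := mem_of_prime_dvd_of_prodPow_eq _ krausList_183150y1 hqF.out hd
    simp only [List.map_cons, List.map_nil, List.mem_cons, List.not_mem_nil, or_false] at hmem
    rcases hmem with rfl | rfl | rfl | rfl | rfl
    · exact (Koly.split_and_three_dvd_of_mult_of_three_dvd_localTamagawaNumber _ 2 (IntModel.hasMultiplicativeReductionAtPrime_of_intModel hI 2 (by rw [Δ_eq_183150y1]; norm_num) (by rw [c₄_eq_183150y1]; norm_num)) h3).1
    · have hc3 : ((⟨1, -1, 1, -2180, 272785447⟩ : WeierstrassCurve ℚ).baseChange ℚ_[3]).localTamagawaNumber ℤ_[3] = 2 := -- additive `3` (I0*): Tate certificate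
        (IntModelTam.localTamagawaNumber_padic_eq_of_intModel_of_tamZ hI 3 (F := ⟨3, 9, 1, 1, 8, 6, 0, 1⟩) rfl (by decide +kernel)).trans (by decide)
      rw [hc3] at h3; exact absurd h3 (by decide)
    · exact absurd rfl hq
    · exact (Koly.split_and_three_dvd_of_mult_of_three_dvd_localTamagawaNumber _ 11 (IntModel.hasMultiplicativeReductionAtPrime_of_intModel hI 11 (by rw [Δ_eq_183150y1]; norm_num) (by rw [c₄_eq_183150y1]; norm_num)) h3).1
    · exact (Koly.split_and_three_dvd_of_mult_of_three_dvd_localTamagawaNumber _ 37 (IntModel.hasMultiplicativeReductionAtPrime_of_intModel hI 37 (by rw [Δ_eq_183150y1]; norm_num) (by rw [c₄_eq_183150y1]; norm_num)) h3).1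
  have hjac : ∀ ℓ : ℕ, ℓ.Prime → ℓ ∣ (⟨1, -1, 1, -2180, 272785447⟩ : WeierstrassCurve ℚ).conductorNorm ℤ → ℓ ≠ 11 → ℓ ≠ 2 → ℓ ≠ 2 →
      jacobiSym (-419) ℓ = 1 := by
    intro ℓ hℓ hℓN hne₁ hne₂ hℓ2
    rw [hN] at hℓN
    have hmem : ℓ ∈ Nat.primeFactors 183150 := Nat.mem_primeFactors.mpr ⟨hℓ, hℓN, by norm_num⟩
    rw [show Nat.primeFactors 183150 = {2, 3, 5, 11, 37} by decide +kernel] at hmem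
    simp only [Finset.mem_insert, Finset.mem_singleton] at hmem
    rcases hmem with rfl | rfl | rfl | rfl | rfl
    · exact absurd rfl hne₂
    · norm_num [jacobiSym.mod_left]
    · norm_num [jacobiSym.mod_left]
    · exact absurd rfl hne₁
    · norm_num [jacobiSym.mod_left]
  have hWd : (⟨1, (-105 : ℚ), ((1:ℚ)/2), (0 : ℚ)⟩ : VariableChange ℚ) • (⟨1, -1, 1, -2180, 272785447⟩ : WeierstrassCurve ℚ).quadraticTwist (((-419 : ℤ) : ℚ)) =
      (⟨1, -1, 0, -382668117, -20066073415048459⟩ : WeierstrassCurve ℚ) := by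
    push_cast; ext <;> simp [WeierstrassCurve.variableChange_a₁, WeierstrassCurve.variableChange_a₂,
      WeierstrassCurve.variableChange_a₃, WeierstrassCurve.variableChange_a₄, WeierstrassCurve.variableChange_a₆,
      WeierstrassCurve.quadraticTwist, WeierstrassCurve.b₂, WeierstrassCurve.b₄, WeierstrassCurve.b₆] <;> norm_num
  exact leafRankOneUpper_three_at_saving_of_sqrtField hGZK hmod hnf hJL hCO hPrim _ hGS.1 hGS.2 hr hsurj rfl Dt hc 5 hbad₁
    (s₁ := 11) (s₂ := 2) (by decide) (by decide) (by decide) hm₁ hm₂ hFC hshape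
    (Or.inl (by rw [IntModel.minimalDiscriminantInt_eq hI, Δ_eq_183150y1, IntModel.padicValInt_eq_of_dvd_of_not_dvd 11 (e := 5) (by norm_num) (by norm_num)]; decide))
    (-419) (by norm_num) (by rw [show (-419 : ℤ).natAbs = 419 by rfl, Nat.squarefree_iff_nodup_primeFactorsList (by norm_num)]; simp)
    (Or.inr ⟨by decide, by norm_num [jacobiSym.mod_left]⟩) (by norm_num) (Or.inl ⟨rfl, by norm_num⟩) (by norm_num) hjac
    (fun _ _ h ↦ absurd rfl h) hLt _ _ hWd hqd hvd

end Summit.BirchSwinnertonDyer.BirchSwinnertonDyer.Theorems.RamifiedHeegnerPairTwistUnitSaving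

end
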